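import Summits.MatrixMultiplication.OmegaCensus.STPPCrossReadingCosetClashTools

/-!
# ω-census (abelian STPP census): `{(2,3,5),(3,2,5)}` has no STPP realisation in any abelian group of order `57` — one Kneser step in the full-coset quotient (kernel)

HONEST FRAMING (pub-omega census; verbatim): lottery ticket; floor = certified bounds/negative ranges.
Census EXCLUSION (seat pub-omega-stpp-2 gen 31, 2026-08-29), family (b2).  Mechanism of `STPPCosetQuotientKillN44/N46.lean`: order `57 = 3·19` (`ℤ₅₇` only),
pattern `{(2,3,5),(3,2,5)}` (a survivor of the kernel lister at order 57; volume 60).  Readings `(A,B,C)` at block `0` and `(B,A,C)` at block `1` pin the outer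
Kneser stabilizer to order `3`: `B₀ = b + K`, `A₁ = a + K`, `K` THE subgroup of order `3` (Hall).  The TPP words give `|(C₁ − B₁) + K| = |(C₀ − A₀) + K| = 30`;
`kLB(30, 30, d) ≥ 57` for every `d ∣ 57` ⇒ `((C₁ − B₁) + K) − ((C₀ − A₀) + K) = H ∋ a₀′ − b`, i.e. the Def-5.1 word `a₀ − a₀′ + b₀ − b₁ + c₁ − c₀` (reading
`(−A,−C,−B)`, indices `(0,1,0)`) vanishes — contradiction.  The reduced order-57 capstone is filed with the order-57 chain (`STPPCosetClashKillsN57.lean`).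
Nothing here is progress on `ω`.

References: M. Kneser, Math. Z. 58 (1953); H. Cohn, R. Kleinberg, B. Szegedy, C. Umans, FOCS 2005 (arXiv:math/0511460), Def. 5.1.
-/

open Finset
open scoped Pointwise

namespace Summit.MatrixMultiplication.OmegaCensus.CubeNB

open Literature.Computability.AlgebraicComplexity
open Literature.Combinatorics.Additive
open Summit.MatrixMultiplication.OmegaCensus.STPPKneser

variable {H : Type*} [AddCommGroup H] [DecidableEq H] [Fintype H]

/-- **`{(2,3,5),(3,2,5)}` has no STPP realisation in any abelian group of order `57`.** [cite: Kneser1953] [cite: CohnKleinbergSzegedyUmans2005, Def. 5.1] -/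
theorem no_isSTPP_card57_235_325 (hH : Fintype.card H = 57) (A B C : Fin 2 → Finset H) (hS : IsSTPP A B C)
    (hA : ∀ i, #(A i) = ![2, 3] i) (hB : ∀ i, #(B i) = ![3, 2] i) (hC : ∀ i, #(C i) = ![5, 5] i) : False := by
  have hAne : ∀ i, (A i).Nonempty := fun i => card_pos.1 (by rw [hA]; fin_cases i <;> simp)
  have hBne : ∀ i, (B i).Nonempty := fun i => card_pos.1 (by rw [hB]; fin_cases i <;> simp)
  have hCne : ∀ i, (C i).Nonempty := fun i => card_pos.1 (by rw [hC]; fin_cases i <;> simp)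
  have hR : IsSTPP (fun j => -(A j)) (fun j => -(C j)) (fun j => -(B j)) := stpp_rotate (stpp_rotate (isSTPP_neg_reverse hS))
  obtain ⟨K1, hK1, hK1q, t1, -, hs1⟩ := exists_carrier_middle_subset_coset' hS hAne hBne hCne 0 ⟨1, by decide⟩
    (n := 57) (q := 3) (z := 15) (b := 3) (vol := 30) (a := 2) (L := 10) hH
    (by simp only [hA]; decide) (by simp only [hB]; decide) (by simp only [hA, hB, hC]; decide)
    (by simp only [hA, hC]; decide) (by simp only [hB, hC]; decide) (by decide)
  obtain ⟨K2, hK2, hK2q, t2, -, hs2⟩ := exists_carrier_middle_subset_coset' (stpp_rotate (isSTPP_neg_reverse hS)) (nonempty_neg_family hBne)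
    (nonempty_neg_family hAne) (nonempty_neg_family hCne) 1 ⟨0, by decide⟩ (n := 57) (q := 3) (z := 15) (b := 3) (vol := 30) (a := 2) (L := 10) hH
    (by simp only [Finset.card_neg, hB]; decide) (by simp only [Finset.card_neg, hA]; decide) (by simp only [Finset.card_neg, hA, hB, hC]; decide)
    (by simp only [Finset.card_neg, hB, hC]; decide) (by simp only [Finset.card_neg, hA, hC]; decide) (by decide)
  have hsub2 : A 1 ⊆ (-t2) +ᵥ K2 := subset_coset_of_neg_subset hK2 hs2
  have hK : K1 = K2 := eq_of_card_eq_coprime hK1 hK2 (m := 19) hK1q hK2q (by rw [hH]) (by decide)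
  subst hK
  set K := K1 with hKdef
  have hB0 : B 0 = t1 +ᵥ K := Finset.eq_of_subset_of_card_le hs1 (by rw [Finset.card_vadd_finset, hK1q, hB]; decide)
  have hA1 : A 1 = (-t2) +ᵥ K := Finset.eq_of_subset_of_card_le hsub2 (by rw [Finset.card_vadd_finset, hK1q, hA]; decide)
  have memB0 : ∀ k ∈ K, t1 + k ∈ B 0 := fun k hk => by rw [hB0]; exact Finset.mem_vadd_finset.2 ⟨k, hk, rfl⟩
  have memA1 : ∀ k ∈ K, -t2 + k ∈ A 1 := fun k hk => by rw [hA1]; exact Finset.mem_vadd_finset.2 ⟨k, hk, rfl⟩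
  have hKne : K.Nonempty := hK1.nonempty
  -- |(C₁ − B₁) + K| = 30 (TPP of block 1, second term from K = A₁ − A₁)
  have hD1 : #(D B C 1 + K) = 30 := by
    rw [← Finset.image_add_product, Finset.card_image_of_injOn, Finset.card_product, card_D_BC hS hAne 1, hB, hC, hK1q]; · rfl
    rintro ⟨d, k⟩ hdk ⟨d', k'⟩ hdk' (h : d + k = d' + k')
    simp only [Finset.coe_product, Set.mem_prod, Finset.mem_coe] at hdk hdk'
    obtain ⟨b, hb, c, hc, rfl⟩ := mem_D.1 hdk.1
    obtain ⟨b', hb', c', hc', rfl⟩ := mem_D.1 hdk'.1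
    have hw : ((-t2 + k) - (-t2 + k')) + (b' - b) + (c - c') = 0 := by
      have : c - b + k - (c' - b' + k') = 0 := sub_eq_zero.2 h
      rw [← this]; abel
    obtain ⟨-, -, h1, h2, h3⟩ := hS 1 1 1 (-t2 + k') (memA1 k' hdk'.2) (-t2 + k) (memA1 k hdk.2) b hb b' hb' c' hc' c hc hw
    have hk : k' = k := by simpa using h1
    rw [h2, h3, hk]
  -- |(C₀ − A₀) + K| = 30 (TPP of block 0, second term from K = B₀ − B₀)
  have hD0 : #(D A C 0 + K) = 30 := by
    rw [← Finset.image_add_product, Finset.card_image_of_injOn, Finset.card_product, card_D_AC hS hBne 0, hA, hC, hK1q]; · rfl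
    rintro ⟨d, k⟩ hdk ⟨d', k'⟩ hdk' (h : d + k = d' + k')
    simp only [Finset.coe_product, Set.mem_prod, Finset.mem_coe] at hdk hdk'
    obtain ⟨a, ha, c, hc, rfl⟩ := mem_D.1 hdk.1
    obtain ⟨a', ha', c', hc', rfl⟩ := mem_D.1 hdk'.1
    have hw : (a' - a) + ((t1 + k) - (t1 + k')) + (c - c') = 0 := by
      have : c - a + k - (c' - a' + k') = 0 := sub_eq_zero.2 h
      rw [← this]; abel
    obtain ⟨-, -, h1, h2, h3⟩ := hS 0 0 0 a ha a' ha' (t1 + k') (memB0 k' hdk'.2) (t1 + k) (memB0 k hdk.2) c' hc' c hc hw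
    have hk : k' = k := by simpa using h2
    rw [h1, h3, hk]
  -- one Kneser step over the divisors of 57
  have hne1 : (D B C 1 + K).Nonempty := (D_nonempty (hBne 1) (hCne 1)).add hKne
  have hne0 : (-(D A C 0 + K)).Nonempty := ((D_nonempty (hAne 0) (hCne 0)).add hKne).neg
  have hUge : 57 ≤ #((D B C 1 + K) + (-(D A C 0 + K))) := by
    obtain ⟨d, hd, hdvd, hk⟩ := exists_dvd_kneserLB_le_card_add (D B C 1 + K) (-(D A C 0 + K)) hne1 hne0
    rw [Finset.card_neg, hD1, hD0, hH] at *
    have hmem : d ∈ Nat.divisors 57 := Nat.mem_divisors.2 ⟨hdvd, by norm_num⟩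
    exact le_trans ((by decide : ∀ d ∈ Nat.divisors 57, 57 ≤ kneserLB 30 30 d) d hmem) hk
  have hU : (D B C 1 + K) + (-(D A C 0 + K)) = univ := Finset.eq_univ_of_card _ (le_antisymm (Finset.card_le_univ _) (hH ▸ hUge))
  -- a₀′ − b ∈ U unfolds to the word a₀ − a₀′ + b₀ − b₁ + c₁ − c₀
  obtain ⟨a0', ha0'⟩ := hAne 0
  have hmem : a0' - t1 ∈ (D B C 1 + K) + (-(D A C 0 + K)) := hU ▸ Finset.mem_univ _
  obtain ⟨x, hx, y, hy, hxy⟩ := Finset.mem_add.1 hmem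
  obtain ⟨d1, hd1, k1, hk1, rfl⟩ := Finset.mem_add.1 hx
  obtain ⟨b1, hb1, c1, hc1, rfl⟩ := mem_D.1 hd1
  rw [Finset.mem_neg] at hy
  obtain ⟨y', hy', hyy⟩ := hy
  obtain ⟨d0, hd0, k0, hk0, rfl⟩ := Finset.mem_add.1 hy'
  obtain ⟨a0, ha0, c0, hc0, rfl⟩ := mem_D.1 hd0
  have hb0 : t1 + (k1 - k0) ∈ B 0 := memB0 _ (hK1.sub_mem hk1 hk0)
  have hword : (-a0 - -a0') + (-c1 - -c0) + (-(t1 + (k1 - k0)) - -b1) = 0 := by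
    have e : c1 - b1 + k1 + y = a0' - t1 := hxy
    rw [← hyy] at e
    have : -a0 - -a0' + (-c1 - -c0) + (-(t1 + (k1 - k0)) - -b1) = -(c1 - b1 + k1 + -(c0 - a0 + k0)) + (a0' - t1) := by abel
    rw [this, e]; abel
  obtain ⟨h01, -⟩ := hR 0 1 0 (-a0') (by simpa using ha0') (-a0) (by simpa using ha0) (-c0) (by simpa using hc0)
    (-c1) (by simpa using hc1) (-b1) (by simpa using hb1) (-(t1 + (k1 - k0))) (by simpa using hb0) hword
  exact absurd h01 (by decide)

/-! ## Non-realisability form (for the order-57 capstone's dead list) -/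

section Dead

open Summit.MatrixMultiplication.OmegaCensus.KLister

/-- `235_325` is not realisable in any abelian group of order `57`. [cite: CohnKleinbergSzegedyUmans2005, Def. 5.1] -/
theorem notRealizable_card57_235_325 (hH : Fintype.card H = 57) : ¬ Realizable H ([(2, 3, 5), (3, 2, 5)] : List Shape) := by
  intro h
  obtain ⟨A, B, C, hS, hc⟩ := h.out
  exact no_isSTPP_card57_235_325 hH A B C hS (fun i => by fin_cases i <;> exact (hc _).2.2.2.1)
    (fun i => by fin_cases i <;> exact (hc _).2.2.2.2.1) (fun i => by fin_cases i <;> exact (hc _).2.2.2.2.2)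

end Dead

end Summit.MatrixMultiplication.OmegaCensus.CubeNB
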